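import Literature.ModelTheory.ExponentialFields.Languages
import Literature.NumberTheory.Transcendental.ExpVarieties
import HarnessLib

/-!
# Brownawell–Masser: exponential points on varieties with dominant additive projection

Trunk T-TRANSCEND (`Literature/NumberTheory/Transcendental`), problem `Schanuel`, route
`Schanuel/Zilber` (`stmt-Schanuel-0074`: instances of exponential-algebraic closedness of
`ℂ_exp`).

W. D. Brownawell and D. W. Masser, *Zero estimates with moving targets*, J. Lond. Math. Soc.
(2) 95 (2017), 441–454, prove a zero estimate "with moving targets" (their Theorem 1.1) and
deduce from it (**Proposition 2, p. 448**) a "non-degenerate" case of Zilber's Nullstellensatz /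
exponential-algebraic closedness for `ℂ_exp`: writing `π : ℂⁿ × (ℂˣ)ⁿ → ℂⁿ` for the projection,

> if `V ⊆ ℂⁿ × (ℂˣ)ⁿ` is an irreducible algebraic variety of dimension `n` such that the Zariski
> closure of `π(V)` has dimension `n`, then `V` contains a point
> `(z₁, …, zₙ, e^{z₁}, …, e^{zₙ})`

(as reported verbatim in V. Mantova, D. Masser, *Polynomial-exponential equations — some new
cases of solvability*, arXiv:2303.05592, §1, who also remark that `dim V ≥ n` suffices). This is
the class recorded here: **dominant projection to the additive factor** (which implies Zilber's
"normality"/rotundity but not freeness), stated over the vocabulary of `ExpVarieties.lean`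
(`IsIrreducibleClosed`, `zariskiDim`, `torusLocus`, `expGraph`; subvarieties of
`Gⁿ = ℂⁿ × (ℂˣ)ⁿ` are presented as `W ∩ torusLocus` with `W` irreducible closed in `ℂ^{2n}`, as
in `IsExpAlgClosed`).

Contents: `projAdd` (the projection `π`), `HasDominantAddProjection V` ("the Zariski closure of
`π(V)` is all of `ℂⁿ`", i.e. no nonzero polynomial in the additive coordinates vanishes on `V`),
the named fact `BrownawellMasser2017_dominantProjection`, and small proved API
(`HasDominantAddProjection.nonempty`, `.mono`).

## References

* W. D. Brownawell, D. W. Masser, *Zero estimates with moving targets*, J. Lond. Math. Soc. (2)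
  95 (2017), 441–454, Thm. 1.1 (zero estimate) and Prop. 2, p. 448 (exponential points).
* V. Mantova, D. Masser, *Polynomial-exponential equations — some new cases of solvability*,
  arXiv:2303.05592 (2023/24), §1 (statement of B–M Prop. 2; the case `dim π(V) = 1`, Thm. 1.1).
* P. D'Aquino, A. Fornasiero, G. Terzo, *Generic solutions of equations with iterated exponentials*,
  Trans. AMS 370 (2018) (related solvability results).
-/

noncomputable section

open MvPolynomial

namespace Literature.NumberTheory.Transcendental

variable {K : Type*} {n : ℕ}

/-- The projection `π : Kⁿ × Kⁿ → Kⁿ` to the additive coordinates (`Sum.inl`).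
[cite: BrownawellMasser2017, Prop. 2 (p. 448)] -/
def projAdd (z : Fin n ⊕ Fin n → K) : Fin n → K :=
  fun i => z (Sum.inl i)

/-- `projAdd` reads the `inl` coordinates. [folklore] -/
@[simp] theorem projAdd_apply (z : Fin n ⊕ Fin n → K) (i : Fin n) : projAdd z i = z (Sum.inl i) :=
  rfl

variable [Field K]

variable (K) in
/-- **Dominant additive projection**: the Zariski closure of `π(V)` is all of `Kⁿ` ("has dimension
`n`" for the irreducible closure), i.e. no nonzero polynomial in the additive coordinates
`X₁, …, Xₙ` vanishes identically on `V`. [cite: BrownawellMasser2017, Prop. 2 (p. 448)] -/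
def HasDominantAddProjection (V : Set (Fin n ⊕ Fin n → K)) : Prop :=
  ∀ p : MvPolynomial (Fin n) K, (∀ z ∈ V, eval (projAdd z) p = 0) → p = 0

/-- A set with dominant additive projection is nonempty (test the constant polynomial `1`).
[folklore] -/
theorem HasDominantAddProjection.nonempty {V : Set (Fin n ⊕ Fin n → K)}
    (h : HasDominantAddProjection K V) : V.Nonempty := by
  by_contra hV
  rw [Set.not_nonempty_iff_eq_empty] at hV
  have := h 1 (by simp [hV])
  exact one_ne_zero this

/-- Dominance of the projection passes to supersets. [folklore] -/
theorem HasDominantAddProjection.mono {V V' : Set (Fin n ⊕ Fin n → K)}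
    (h : HasDominantAddProjection K V) (hVV' : V ⊆ V') : HasDominantAddProjection K V' :=
  fun p hp => h p fun z hz => hp z (hVV' hz)

/-- **Brownawell–Masser 2017, Proposition 2** (p. 448; consequence of the zero estimate with moving
targets, Thm. 1.1; statement as reported in Mantova–Masser 2023, §1). Let
`V = W ∩ (ℂⁿ × (ℂˣ)ⁿ)` be an irreducible algebraic subvariety of `ℂⁿ × (ℂˣ)ⁿ` — `W ⊆ ℂ^{2n}`
irreducible Zariski closed of dimension `n`, meeting the torus locus — whose projection to the
additive factor `ℂⁿ` is dominant (`HasDominantAddProjection`, "the Zariski closure of `π(V)` has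
dimension `n`"). Then `V` contains a point of the graph of exponentiation:
`(z₁, …, zₙ, e^{z₁}, …, e^{zₙ}) ∈ V` for some `z ∈ ℂⁿ` (`expGraph ℂ n ⊆ torusLocus ℂ n`, so
`W ∩ expGraph = V ∩ expGraph`). An instance of exponential-algebraic closedness of `ℂ_exp` for the
class of varieties with dominant additive projection.
[cite: BrownawellMasser2017, Prop. 2 (p. 448)] -/
def BrownawellMasser2017_dominantProjection : Prop :=
  ∀ (n : ℕ) (W : Set (Fin n ⊕ Fin n → ℂ)), IsIrreducibleClosed ℂ W → zariskiDim ℂ W = n →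
    HasDominantAddProjection ℂ (W ∩ torusLocus ℂ n) → (W ∩ expGraph ℂ n).Nonempty

/-- Under `BrownawellMasser2017_dominantProjection` the exponential point found lies in
`V = W ∩ torusLocus` itself (the graph of `exp` consists of torus points). [folklore] -/
theorem BrownawellMasser2017_dominantProjection.exists_mem
    (h : BrownawellMasser2017_dominantProjection) {n : ℕ} {W : Set (Fin n ⊕ Fin n → ℂ)}
    (hW : IsIrreducibleClosed ℂ W) (hdim : zariskiDim ℂ W = n)
    (hdom : HasDominantAddProjection ℂ (W ∩ torusLocus ℂ n)) :
    ∃ z ∈ W ∩ torusLocus ℂ n, z ∈ expGraph ℂ n := by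
  obtain ⟨z, hzW, hzE⟩ := h n W hW hdim hdom
  exact ⟨z, ⟨hzW, expGraph_subset_torusLocus hzE⟩, hzE⟩

end Literature.NumberTheory.Transcendental
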